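import Summits.Parity.GeneralizedHardyLittlewood.Theorems.PrimeLevelFamEdgeMomentsBeyondDiagonalExplicitAtOne
import Summits.Parity.GeneralizedHardyLittlewood.Theorems.PrimeLevelFamEdgeMomentsBeyondDiagonalRefutationShapes
import HarnessLib

/-!
# Route `PrimeLevelFamEdge`, crux K_A `MomentsBeyondDiagonal` (stmt-Parity-20007), line «petersson_layers» v4:
# REFUTATION SHAPES FOR THE CRUX IN EXPLICIT (cusp-form-free) TERMS (lead prover, 2026-08-28; helper — disprover-facing)

The lead's shapes of record (`…RefutationShapes`, p624994: two fitting limits / unboundedness of the NORMALISED SECOND MOMENT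
`Q^h(P,Q)` kill K_A) still contain the harmonic average over `S₂(q)*`. With the identification at `Q = 1`
(`norm_QhPQ_one_sub_explicit_le`, p634719: `Q^h(P,1)(q̂^{Δ'}) = [diagPart q P 1 Δ' − Σ_{r ≤ q⁸} layer q P 1 Δ' r] + O(q̂ log⁻³ q̂)`)
they transfer to the EXPLICIT finite sum `E_q(P,Δ') := diagPart q P 1 Δ' − Σ_{r∈[1,q⁸]} layer q P 1 Δ' r` — Kloosterman sums `S(a,b;qr)`,
Bessel values `J₁`, Möbius coefficients, KMV's cut-off `W`, nothing automorphic: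
* `not_momentsBeyondDiagonal_of_explicit_two_fits`: if on every window `(1, Δ₁]` some admissible `P` and `Δ' ≤ 3/2` have the
  normalised explicit sum `E_q(P,Δ')/(2ζ(2)² q̂/(Δ'² log² q̂))` fitting two DISTINCT constants along two unbounded sets of good primes,
  then `¬ MomentsBeyondDiagonal`;
* `not_momentsBeyondDiagonal_of_explicit_unbounded`: if it is unbounded along good primes on every window, `¬ MomentsBeyondDiagonal`.
Tools, not claims: no such witness is known or asserted; in the route's (A)-world heuristic the level-signed layers would produce the
first. No exceptional-zero statement is proved or claimed.
-/

noncomputable section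

open scoped Real
open Complex Finset Polynomial
open Literature.NumberTheory.LFunctions

namespace Summit.Parity.GeneralizedHardyLittlewood.Theorems.PrimeLevelFamEdgeIdeaDeltas.PeterssonLayers

open Summit.Parity.GeneralizedHardyLittlewood.Theses.PrimeLevelFamEdge (MomentsBeyondDiagonal)

/-- Transfer of an infinitely-often fit from the explicit sum to `Q^h(P,1)` (the constant grows by the identification constant). -/
theorem frequently_fit_QhPQ_of_explicit (P : ℝ[X]) {Δ' : ℝ} (h1 : 1 < Δ') (h32 : Δ' ≤ 3 / 2) {t' C' : ℝ}
    (hio : ∀ q₀ : ℕ, ∃ q : ℕ, ∃ _ : NeZero q, q.Prime ∧ q₀ ≤ q ∧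
      (∀ n : ℕ, (n : ℝ) ≠ KMV2000.qhat q ^ Δ') ∧
        ‖(diagPart q P 1 Δ' - ∑ r ∈ Icc 1 (q ^ 8), layer q P 1 Δ' r) -
            ((2 * riemannZeta 2 ^ 2 *
                ((KMV2000.qhat q / (Δ' ^ 2 * Real.log (KMV2000.qhat q) ^ 2) : ℝ) : ℂ)) * ((t' : ℝ) : ℂ))‖ ≤
          C' * KMV2000.qhat q * (Real.log (KMV2000.qhat q))⁻¹ ^ 3) :
    ∃ C : ℝ, ∀ q₀ : ℕ, ∃ q : ℕ, ∃ _ : NeZero q, q.Prime ∧ q₀ ≤ q ∧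
      (∀ n : ℕ, (n : ℝ) ≠ KMV2000.qhat q ^ Δ') ∧
        ‖KMV2000.QhPQ q P 1 (KMV2000.qhat q ^ Δ') -
            ((2 * riemannZeta 2 ^ 2 *
                ((KMV2000.qhat q / (Δ' ^ 2 * Real.log (KMV2000.qhat q) ^ 2) : ℝ) : ℂ)) * ((t' : ℝ) : ℂ))‖ ≤
          C * KMV2000.qhat q * (Real.log (KMV2000.qhat q))⁻¹ ^ 3 := by
  obtain ⟨C₁, hC₁⟩ := norm_QhPQ_one_sub_explicit_le P
  refine ⟨C₁ + C', fun q₀ ↦ ?_⟩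
  obtain ⟨q, hq0, hq, hq₀, hgen, hfit⟩ := hio (max q₀ 64)
  refine ⟨q, hq0, hq, le_trans (le_max_left _ _) hq₀, hgen, ?_⟩
  have hB := hC₁ Δ' h1 h32 q hq (le_trans (le_max_right _ _) hq₀)
  calc _ = ‖(KMV2000.QhPQ q P 1 (KMV2000.qhat q ^ Δ') -
            (diagPart q P 1 Δ' - ∑ r ∈ Icc 1 (q ^ 8), layer q P 1 Δ' r)) +
          ((diagPart q P 1 Δ' - ∑ r ∈ Icc 1 (q ^ 8), layer q P 1 Δ' r) -
            ((2 * riemannZeta 2 ^ 2 *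
                ((KMV2000.qhat q / (Δ' ^ 2 * Real.log (KMV2000.qhat q) ^ 2) : ℝ) : ℂ)) * ((t' : ℝ) : ℂ)))‖ := by
        ring_nf
    _ ≤ _ := norm_add_le _ _
    _ ≤ C₁ * KMV2000.qhat q * (Real.log (KMV2000.qhat q))⁻¹ ^ 3 +
          C' * KMV2000.qhat q * (Real.log (KMV2000.qhat q))⁻¹ ^ 3 := add_le_add hB hfit
    _ = (C₁ + C') * KMV2000.qhat q * (Real.log (KMV2000.qhat q))⁻¹ ^ 3 := by ring

/-- **TWO LIMITS OF THE EXPLICIT SUM KILL K_A.** If for every `Δ₁ > 1` there are `Δ' ∈ (1, min Δ₁ 3/2]`, an admissible `P` and two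
DISTINCT constants `t' ≠ t''` each fitting the explicit sum `diagPart q P 1 Δ' − Σ_{r ≤ q⁸} layer q P 1 Δ' r` within `C q̂ log⁻³ q̂` of
`2ζ(2)² q̂/(Δ'² log² q̂)·t` along unbounded sets of good primes (`q̂^{Δ'} ∉ ℕ`), then `¬ MomentsBeyondDiagonal`. -/
theorem not_momentsBeyondDiagonal_of_explicit_two_fits
    (H : ∀ Δ₁ : ℝ, 1 < Δ₁ → ∃ Δ' : ℝ, 1 < Δ' ∧ Δ' ≤ Δ₁ ∧ Δ' ≤ 3 / 2 ∧ ∃ P : ℝ[X], KMV2000.Admissible P ∧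
      ∃ t' t'' C' C'' : ℝ, t' ≠ t'' ∧
        (∀ q₀ : ℕ, ∃ q : ℕ, ∃ _ : NeZero q, q.Prime ∧ q₀ ≤ q ∧
          (∀ n : ℕ, (n : ℝ) ≠ KMV2000.qhat q ^ Δ') ∧
            ‖(diagPart q P 1 Δ' - ∑ r ∈ Icc 1 (q ^ 8), layer q P 1 Δ' r) -
                ((2 * riemannZeta 2 ^ 2 *
                    ((KMV2000.qhat q / (Δ' ^ 2 * Real.log (KMV2000.qhat q) ^ 2) : ℝ) : ℂ)) * ((t' : ℝ) : ℂ))‖ ≤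
              C' * KMV2000.qhat q * (Real.log (KMV2000.qhat q))⁻¹ ^ 3) ∧
        (∀ q₀ : ℕ, ∃ q : ℕ, ∃ _ : NeZero q, q.Prime ∧ q₀ ≤ q ∧
          (∀ n : ℕ, (n : ℝ) ≠ KMV2000.qhat q ^ Δ') ∧
            ‖(diagPart q P 1 Δ' - ∑ r ∈ Icc 1 (q ^ 8), layer q P 1 Δ' r) -
                ((2 * riemannZeta 2 ^ 2 *
                    ((KMV2000.qhat q / (Δ' ^ 2 * Real.log (KMV2000.qhat q) ^ 2) : ℝ) : ℂ)) * ((t'' : ℝ) : ℂ))‖ ≤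
              C'' * KMV2000.qhat q * (Real.log (KMV2000.qhat q))⁻¹ ^ 3)) :
    ¬ MomentsBeyondDiagonal := by
  apply not_momentsBeyondDiagonal_of_two_fits
  intro Δ₁ hΔ₁
  obtain ⟨Δ', h1, h2, h32, P, hP, t', t'', C', C'', hne, hio', hio''⟩ := H Δ₁ hΔ₁
  obtain ⟨D', hD'⟩ := frequently_fit_QhPQ_of_explicit P h1 h32 hio'
  obtain ⟨D'', hD''⟩ := frequently_fit_QhPQ_of_explicit P h1 h32 hio''
  exact ⟨Δ', h1, h2, P, 1, hP, KMV2000.isEvenOrOdd_one, t', t'', D', D'', hne, hD', hD''⟩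

/-- **UNBOUNDEDNESS OF THE EXPLICIT SUM KILLS K_A.** If for every `Δ₁ > 1` there are `Δ' ∈ (1, min Δ₁ 3/2]` and an admissible `P`
such that the explicit sum exceeds `K · q̂/(Δ'² log² q̂)` for every `K` along good primes beyond every threshold, then
`¬ MomentsBeyondDiagonal`. -/
theorem not_momentsBeyondDiagonal_of_explicit_unbounded
    (H : ∀ Δ₁ : ℝ, 1 < Δ₁ → ∃ Δ' : ℝ, 1 < Δ' ∧ Δ' ≤ Δ₁ ∧ Δ' ≤ 3 / 2 ∧ ∃ P : ℝ[X], KMV2000.Admissible P ∧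
      ∀ K : ℝ, ∀ q₀ : ℕ, ∃ q : ℕ, ∃ _ : NeZero q, q.Prime ∧ q₀ ≤ q ∧
        (∀ n : ℕ, (n : ℝ) ≠ KMV2000.qhat q ^ Δ') ∧
          K * (KMV2000.qhat q / (Δ' ^ 2 * Real.log (KMV2000.qhat q) ^ 2)) <
            ‖diagPart q P 1 Δ' - ∑ r ∈ Icc 1 (q ^ 8), layer q P 1 Δ' r‖) :
    ¬ MomentsBeyondDiagonal := by
  apply not_momentsBeyondDiagonal_of_unbounded
  intro Δ₁ hΔ₁
  obtain ⟨Δ', h1, h2, h32, P, hP, hub⟩ := H Δ₁ hΔ₁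
  obtain ⟨C₁, hC₁⟩ := norm_QhPQ_one_sub_explicit_le P
  refine ⟨Δ', h1, h2, P, 1, hP, KMV2000.isEvenOrOdd_one, fun K q₀ ↦ ?_⟩
  -- at level `q ≥ 300`: `log q̂ ≥ 1`, so the identification error `C₁ q̂ log⁻³ q̂ ≤ |C₁|Δ'² · q̂/(Δ'² log² q̂)` is absorbed
  obtain ⟨q, hq0, hq, hq₀, hgen, hbig⟩ := hub (K + |C₁| * Δ' ^ 2) (max q₀ 300)
  have h300 : 300 ≤ q := le_trans (le_max_right _ _) hq₀
  have h64 : 64 ≤ q := le_trans (by norm_num) h300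
  refine ⟨q, hq0, hq, le_trans (le_max_left _ _) hq₀, hgen, ?_⟩
  have hB := hC₁ Δ' h1 h32 q hq h64
  have hqh0 : 0 < KMV2000.qhat q := zero_lt_one.trans (one_lt_qhat h64)
  have hℓ : 1 ≤ Real.log (KMV2000.qhat q) := KMV2000.one_le_log_qhat h300
  have hℓ0 : 0 < Real.log (KMV2000.qhat q) := by linarith
  have hinv0 : 0 ≤ (Real.log (KMV2000.qhat q))⁻¹ := inv_nonneg.mpr hℓ0.le
  have hinv1 : (Real.log (KMV2000.qhat q))⁻¹ ≤ 1 := inv_le_one_of_one_le₀ hℓ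
  have hpow : (Real.log (KMV2000.qhat q))⁻¹ ^ 3 ≤ (Real.log (KMV2000.qhat q))⁻¹ ^ 2 :=
    pow_le_pow_of_le_one hinv0 hinv1 (by norm_num)
  have hΔ0 : 0 < Δ' := by linarith
  -- the identification error in the normalisation `q̂/(Δ'² log² q̂)`
  have herr : C₁ * KMV2000.qhat q * (Real.log (KMV2000.qhat q))⁻¹ ^ 3 ≤
      |C₁| * Δ' ^ 2 * (KMV2000.qhat q / (Δ' ^ 2 * Real.log (KMV2000.qhat q) ^ 2)) := by
    have e : |C₁| * Δ' ^ 2 * (KMV2000.qhat q / (Δ' ^ 2 * Real.log (KMV2000.qhat q) ^ 2)) =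
        |C₁| * KMV2000.qhat q * (Real.log (KMV2000.qhat q))⁻¹ ^ 2 := by
      field_simp
    rw [e]
    calc C₁ * KMV2000.qhat q * (Real.log (KMV2000.qhat q))⁻¹ ^ 3
        ≤ |C₁| * KMV2000.qhat q * (Real.log (KMV2000.qhat q))⁻¹ ^ 3 := by
          gcongr; exact le_abs_self _
      _ ≤ |C₁| * KMV2000.qhat q * (Real.log (KMV2000.qhat q))⁻¹ ^ 2 :=
          mul_le_mul_of_nonneg_left hpow (by positivity)
  have htri : ‖diagPart q P 1 Δ' - ∑ r ∈ Icc 1 (q ^ 8), layer q P 1 Δ' r‖ ≤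
      ‖KMV2000.QhPQ q P 1 (KMV2000.qhat q ^ Δ')‖ +
        ‖KMV2000.QhPQ q P 1 (KMV2000.qhat q ^ Δ') -
          (diagPart q P 1 Δ' - ∑ r ∈ Icc 1 (q ^ 8), layer q P 1 Δ' r)‖ := by
    have h := norm_sub_le (KMV2000.QhPQ q P 1 (KMV2000.qhat q ^ Δ'))
      (KMV2000.QhPQ q P 1 (KMV2000.qhat q ^ Δ') - (diagPart q P 1 Δ' - ∑ r ∈ Icc 1 (q ^ 8), layer q P 1 Δ' r))
    rw [sub_sub_cancel] at h
    exact h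
  have hsplit : (K + |C₁| * Δ' ^ 2) * (KMV2000.qhat q / (Δ' ^ 2 * Real.log (KMV2000.qhat q) ^ 2)) =
      K * (KMV2000.qhat q / (Δ' ^ 2 * Real.log (KMV2000.qhat q) ^ 2)) +
        |C₁| * Δ' ^ 2 * (KMV2000.qhat q / (Δ' ^ 2 * Real.log (KMV2000.qhat q) ^ 2)) := by ring
  linarith

end Summit.Parity.GeneralizedHardyLittlewood.Theorems.PrimeLevelFamEdgeIdeaDeltas.PeterssonLayers

end
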